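import Summits.QuantumFields.YangMills.Theorems.BalabanLadderIRColdPurityBridge
import Summits.QuantumFields.YangMills.Theorems.BalabanLadderIRColdDoublingRecursionSC
import HarnessLib

/-!
# Line `entropy-staircase` on crux `BalabanLadder.IR` (stmt-QuantumFields-19354) — lens «strengthen-to-induct»

Seat ym-ir-idea-14 g0 (planner, ideator; cell ym-ir; critic ym-ir-crit-4).  HONEST FRAMING: nothing in this file proves the
Yang–Mills mass gap (Clay), a lattice gap, or `BalabanLadder.IR`; R4 of the ladder closes only the conditional finite-𝕋⁴
rung `BalabanLadder.UV`.  This is a conditional skeleton: sorries live ONLY in the registered `stub_*` theorems.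

THE STRENGTHENING S⁺ (trace-excess / purity currency, induction on dyadic scales).  Let
`S₂(β,L) := −log(1 − δᶜ_β(L)) = −log( Z_β(L³×2⌊L/4⌋) / Z_β(L³×⌊L/4⌋)² )` be the thermal Rényi-2 entropy of the
aspect-`4:1` torus state (`coldDefect` of `ColdPurityBridge`; `2 log(1+x_t) − log(1+x_{2t})` in trace excesses).
S⁺ says that `S₂` is a STRICT LYAPUNOV FUNCTION OF THE SCALE-DOUBLING MAP at fixed coupling:
* `HotOctaveDecrementSC` (A, the load): while `S₂(β,L) ≥ s`, one octave costs at least `κ(β,s) > 0` nats, uniformly in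
  `L ≥ L₁` (asymptotic freedom read as toron/plasma entropy running in UV octaves; deconfinement collapse at the crossover;
  for `U(1)₄` (Coulomb) and `π₁(G) ≠ 1` (flux vacua) the decrements tend to `0` — simplicity and `π₁ = 1` are load-bearing);
* `ColdOctaveHalvingSC` (B): below some `s > 0` one octave contracts `S₂` by a factor `θ < 1` uniformly in `β`
  (sub-`s` entropy at aspect 4 is carried by states with `E·t ≳ 4`, whose doubling weight is `2^{3/2}e^{−Et} ≪ 1`).
Telescoping (the induction on scales, REAL proof `coldExitSC_of_staircase`) gives the exit `E = ColdExitSC` at every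
tolerance; `IR` then follows BY NAME from the tree: `IR_of_bridge` with `R = coldDoublingRecursionSC_holds` (p596893),
the pincer's AF pin `X = AFToColdPressure` and the residual `N = IRnsc` (both inherited, shared with lines 1/6/13/15).

Cheapest falsifier run (exact, local): free lattice boson per polarisation at aspect 4:1, `S₂(L)` for
`L = 4,8,16,32,64` = 17.80, 26.16, 17.05, 12.72, 12.02 (continuum 11.81): octave decrements +9.11, +4.33, +0.71 for
`L ≥ 8` but −8.36 for `4 → 8` — hence `L₁ ≥ 8` in A.  Card: `Cruxes/IR/Lines/entropy-staircase.md`.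
-/

noncomputable section

open Literature.MathematicalPhysics.QuantumFieldTheory
open Summit.QuantumFields.YangMills.Cruxes.IR.ColdPurityBridge
open Summit.QuantumFields.YangMills.Cruxes.IR.ColdPressurePincer

namespace Summit.QuantumFields.YangMills.Cruxes.IR.EntropyStaircase

/-! ## §1 The currency: thermal Rényi-2 entropy of the aspect-4:1 torus -/

section Currency

variable {G : Type} [Group G] [TopologicalSpace G] [IsTopologicalGroup G] [CompactSpace G]
  [MeasurableSpace G] [BorelSpace G]

/-- `S₂(β,L) = −log(1 − δᶜ_β(L)) = −log( Z(L,L,L,2⌊L/4⌋) / Z(L,L,L,⌊L/4⌋)² )`, the thermal Rényi-2 entropy of the torus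
state of spatial side `L` at inverse temperature `⌊L/4⌋`. -/
def renyiTwo {N : ℕ} (ρ : G →* Matrix (Fin N) (Fin N) ℂ) (β : ℝ) (L : ℕ) : ℝ :=
  -Real.log (1 - coldDefect ρ β L)

variable [SecondCountableTopology G]

/-- The purity `1 − δᶜ` is a ratio of (strictly positive) Wilson partition functions. -/
theorem one_sub_coldDefect_pos {N : ℕ} {ρ : G →* Matrix (Fin N) (Fin N) ℂ} (hρ : Continuous ρ) (β : ℝ) (L : ℕ) :
    0 < 1 - coldDefect ρ β L := by
  unfold coldDefect
  have h1 := wilsonFinTorusPartition_pos hρ β L L L (2 * (L / 4))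
  have h2 := wilsonFinTorusPartition_pos hρ β L L L (L / 4)
  have : 0 < wilsonFinTorusPartition ρ β L L L (2 * (L / 4)) / wilsonFinTorusPartition ρ β L L L (L / 4) ^ 2 :=
    div_pos h1 (pow_pos h2 2)
  linarith

/-- `δᶜ = 1 − e^{−S₂}`. -/
theorem coldDefect_eq_one_sub_exp {N : ℕ} {ρ : G →* Matrix (Fin N) (Fin N) ℂ} (hρ : Continuous ρ) (β : ℝ) (L : ℕ) :
    coldDefect ρ β L = 1 - Real.exp (-renyiTwo ρ β L) := by
  unfold renyiTwo
  rw [neg_neg, Real.exp_log (one_sub_coldDefect_pos hρ β L)]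
  ring

/-- `δᶜ ≤ S₂` (from `1 − s ≤ e^{−s}`). -/
theorem coldDefect_le_renyiTwo {N : ℕ} {ρ : G →* Matrix (Fin N) (Fin N) ℂ} (hρ : Continuous ρ) (β : ℝ) (L : ℕ) :
    coldDefect ρ β L ≤ renyiTwo ρ β L := by
  rw [coldDefect_eq_one_sub_exp hρ β L]
  have h := Real.add_one_le_exp (-renyiTwo ρ β L)
  linarith

end Currency

/-! ## §2 The strengthening S⁺ = A ∧ B (two REGISTERED stubs) -/

/-- **A — `HotOctaveDecrementSC` (the LOAD; XL).**  For compact simple simply-connected `G`, every `r` and every entropy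
level `s > 0` there are `β₀`, `L₁` such that for every `β ≥ β₀` some `κ > 0` is lost at EVERY octave that starts at
entropy `≥ s`: `S₂(β,2L) ≤ S₂(β,L) − κ` for all `L ≥ L₁` with `S₂(β,L) ≥ s`.  (`κ` may depend on `β`: `E` is per-`β`.)
Why it might fail: an octave window (growing with `β`) in which the aspect-4 entropy is scale-STATIONARY — an infrared
conformal / Coulomb-like regime of the `SU(N)` Wilson theory — makes `inf_L` of the decrement `0`; exactly this happens for
`U(1)₄` at `β > β_c` (decrements = lattice artefacts `→ 0`) and for `π₁(G) ≠ 1` (`S₂ → log |π₁|³`).  In UV octaves the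
decrement is `≈ (2 d_tor b₀ ln 2 / 3)·g²(L) + O(L⁻²) > 0` (toron entropy running + dispersion artefacts), located in the
Bałaban small-field / Lüscher femto-universe class but unprinted; through the plasma/crossover octaves no mechanism is
located (this is the wall «no conformal window», census B7, met in entropy currency).
Sources: Luscher1983 (NPB 219, 233), vanBaalKoller1987 (Ann. Phys. 174, 299), Boyd et al. NPB 469 (1996) 419 (integral
method), Caselle–Nada–Panero et al. PRD 94 (2016) 034503 / PRD 98 (2018) 054513 (Z-ratios by Jarzynski),
Komargodski–Schwimmer JHEP 12 (2011) 099 (a-theorem: the global UV→IR version), `Literature.Barriers.QuantumFields.AbelianDeconfinementD4`. -/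
def HotOctaveDecrementSC : Prop :=
  ∀ (G : Type) [Group G] [TopologicalSpace G] [IsTopologicalGroup G] [CompactSpace G],
    IsCompactSimpleLieGroup G → SimplyConnectedSpace G →
    letI : MeasurableSpace G := borel G
    haveI : BorelSpace G := ⟨rfl⟩
    ∀ r : LatticeRep G, ∀ s : ℝ, 0 < s → ∃ β₀ : ℝ, ∃ L₁ : ℕ, ∀ β : ℝ, β₀ ≤ β → ∃ κ : ℝ, 0 < κ ∧
      ∀ L : ℕ, L₁ ≤ L → s ≤ renyiTwo r.ρ β L → renyiTwo r.ρ β (2 * L) ≤ renyiTwo r.ρ β L - κ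

/-- **B — `ColdOctaveHalvingSC` (L–XL; the crossover hand-over in entropy currency).**  For compact simple
simply-connected `G` and every `r` there are an entropy level `s > 0`, a contraction factor `0 < θ < 1`, `β₀` and `L₁`
such that for all `β ≥ β₀`, `L ≥ L₁`: `S₂(β,L) < s ⟹ S₂(β,2L) ≤ θ · S₂(β,L)`.
Why it might fail: kinematically, `S₂ < s` small forces the thermally relevant levels to have `E·⌊L/4⌋ ≳ 4`, and doubling
multiplies a one-particle weight by `2^{3/2}e^{−E t} ≪ 1` — but a light state whose multiplicity grows faster than `8×`
per spatial doubling (non-particle-like spectrum at the crossover scale), or torelons of an almost-vanishing effective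
string tension in a `4:1` box, could keep `S₂(2L) > θ S₂(L)`; the only group-blind contraction known is R with
`C = 2·432²e^{432}`, useless at `S₂ ≍ s`.  For `π₁(G) ≠ 1` the hypothesis never triggers below `s < log |π₁|³`.
Sources: Luscher1977 (CMP 54, 283), Montvay–Münster §3.2.6, Knabe1988, `Theorems/BalabanLadderIRColdDoublingRecursionSC`
(R, p596893), Meyer (JHEP 0401:030 / high-T glueball multiplicities), `pub/ym-ir/REDUCTION-CENSUS.md` §1 «×-window». -/
def ColdOctaveHalvingSC : Prop :=
  ∀ (G : Type) [Group G] [TopologicalSpace G] [IsTopologicalGroup G] [CompactSpace G],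
    IsCompactSimpleLieGroup G → SimplyConnectedSpace G →
    letI : MeasurableSpace G := borel G
    haveI : BorelSpace G := ⟨rfl⟩
    ∀ r : LatticeRep G, ∃ s θ β₀ : ℝ, ∃ L₁ : ℕ, 0 < s ∧ 0 < θ ∧ θ < 1 ∧ ∀ β : ℝ, β₀ ≤ β →
      ∀ L : ℕ, L₁ ≤ L → renyiTwo r.ρ β L < s → renyiTwo r.ρ β (2 * L) ≤ θ * renyiTwo r.ρ β L

/-! ## §3 The induction on scales, PROVED: A ∧ B ⇒ E (`ColdExitSC`) -/

section Induction

variable {G : Type} [Group G] [TopologicalSpace G] [IsTopologicalGroup G] [CompactSpace G]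
  [MeasurableSpace G] [BorelSpace G]

/-- Telescoping the hot decrement: if every octave starting at entropy `≥ s` from `L₁` on loses `κ > 0`, then along the
dyadic tower over any `L ≥ L₁` some octave starts below `s`. -/
theorem exists_pow_mul_lt_of_decrement {N : ℕ} (ρ : G →* Matrix (Fin N) (Fin N) ℂ) (β : ℝ) {s κ : ℝ} (hκ : 0 < κ)
    {L₁ L : ℕ} (hL : L₁ ≤ L)
    (hdec : ∀ L' : ℕ, L₁ ≤ L' → s ≤ renyiTwo ρ β L' → renyiTwo ρ β (2 * L') ≤ renyiTwo ρ β L' - κ) :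
    ∃ k : ℕ, renyiTwo ρ β (2 ^ k * L) < s := by
  by_contra h
  push Not at h
  -- `S₂(2^k L) ≤ S₂(L) − k κ` for every `k`
  have step : ∀ k : ℕ, renyiTwo ρ β (2 ^ k * L) ≤ renyiTwo ρ β L - k * κ := by
    intro k
    induction k with
    | zero => simp
    | succ k ih =>
      have hk : L₁ ≤ 2 ^ k * L := le_trans hL (Nat.le_mul_of_pos_left L (Nat.two_pow_pos k))
      have h1 := hdec (2 ^ k * L) hk (h k)
      have h2 : 2 * (2 ^ k * L) = 2 ^ (k + 1) * L := by ring
      rw [h2] at h1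
      have : ((k + 1 : ℕ) : ℝ) * κ = (k : ℝ) * κ + κ := by push_cast; ring
      rw [this]
      linarith
  -- choose `k` with `k κ > S₂(L) − s`
  obtain ⟨k, hk⟩ := exists_nat_gt ((renyiTwo ρ β L - s) / κ)
  have hk' : renyiTwo ρ β L - s < k * κ := by
    rwa [div_lt_iff₀ hκ] at hk
  have := step k
  have := h k
  linarith

/-- Iterating the cold contraction: once below `s`, `j` further octaves give `S₂ ≤ θ^j · s`. -/
theorem renyiTwo_le_pow_of_contraction {N : ℕ} (ρ : G →* Matrix (Fin N) (Fin N) ℂ) (β : ℝ) {s θ : ℝ}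
    (hsp : 0 < s) (hθ : 0 < θ) (hθ1 : θ < 1) {L₁ L : ℕ} (hL : L₁ ≤ L) (hs : renyiTwo ρ β L < s)
    (hcon : ∀ L' : ℕ, L₁ ≤ L' → renyiTwo ρ β L' < s → renyiTwo ρ β (2 * L') ≤ θ * renyiTwo ρ β L') :
    ∀ j : ℕ, renyiTwo ρ β (2 ^ j * L) ≤ θ ^ j * s := by
  intro j
  induction j with
  | zero => simpa using hs.le
  | succ j ih =>
    have hj : L₁ ≤ 2 ^ j * L := le_trans hL (Nat.le_mul_of_pos_left L (Nat.two_pow_pos j))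
    -- the octave starting at `2^j L` is below `s` (`θ^j ≤ 1`)
    have hθj : θ ^ j ≤ 1 := pow_le_one₀ hθ.le hθ1.le
    have hlt : renyiTwo ρ β (2 ^ j * L) < s := by
      rcases Nat.eq_zero_or_pos j with rfl | hjpos
      · simpa using hs
      · have hθj' : θ ^ j < 1 := pow_lt_one₀ hθ.le hθ1 (Nat.pos_iff_ne_zero.mp hjpos)
        calc renyiTwo ρ β (2 ^ j * L) ≤ θ ^ j * s := ih
          _ < 1 * s := mul_lt_mul_of_pos_right hθj' hsp
          _ = s := one_mul s
    have h1 := hcon (2 ^ j * L) hj hlt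
    have h2 : 2 * (2 ^ j * L) = 2 ^ (j + 1) * L := by ring
    rw [h2] at h1
    calc renyiTwo ρ β (2 ^ (j + 1) * L) ≤ θ * renyiTwo ρ β (2 ^ j * L) := h1
      _ ≤ θ * (θ ^ j * s) := mul_le_mul_of_nonneg_left ih hθ.le
      _ = θ ^ (j + 1) * s := by ring

end Induction

/-- **A ∧ B ⇒ E (REAL proof — the induction on scales).**  Per `(G, r)`: B gives `(s, θ, β₀ᴮ, L₁ᴮ)`; A at level `s` gives
`(β₀ᴬ, L₁ᴬ)`; for `β ≥ max β₀ᴬ β₀ᴮ` and any `L₀`, start the dyadic tower at `L := max L₀ (max L₁ᴬ L₁ᴮ)`: the hot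
decrement brings some octave below `s` (`exists_pow_mul_lt_of_decrement`), the cold contraction then drives `S₂ ≤ θ^j s ≤ ε`
(`renyiTwo_le_pow_of_contraction`, `exists_pow_lt_of_lt_one`), and `δᶜ ≤ S₂` (`coldDefect_le_renyiTwo`). -/
theorem coldExitSC_of_staircase (hA : HotOctaveDecrementSC) (hB : ColdOctaveHalvingSC) : ColdExitSC := by
  intro G _ _ _ _ hG hsc
  letI : MeasurableSpace G := borel G
  haveI : BorelSpace G := ⟨rfl⟩
  intro r ε hε
  haveI : SecondCountableTopology G :=
    (r.continuous.isClosedEmbedding r.injective).isEmbedding.secondCountableTopology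
  obtain ⟨s, θ, β₀B, L₁B, hs, hθ, hθ1, hcon⟩ := hB G hG hsc r
  obtain ⟨β₀A, L₁A, hdecA⟩ := hA G hG hsc r s hs
  refine ⟨max β₀A β₀B, fun β hβ L₀ => ?_⟩
  have hβA : β₀A ≤ β := le_trans (le_max_left _ _) hβ
  have hβB : β₀B ≤ β := le_trans (le_max_right _ _) hβ
  obtain ⟨κ, hκ, hdec⟩ := hdecA β hβA
  set L : ℕ := max L₀ (max L₁A L₁B) with hLdef
  have hLA : L₁A ≤ L := le_trans (le_max_left _ _) (le_max_right _ _)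
  have hLB : L₁B ≤ L := le_trans (le_max_right _ _) (le_max_right _ _)
  have hL0 : L₀ ≤ L := le_max_left _ _
  -- hot phase: some octave `2^k L` starts below `s`
  obtain ⟨k, hk⟩ := exists_pow_mul_lt_of_decrement r.ρ β hκ hLA hdec
  -- cold phase from `L' := 2^k L`
  have hL'B : L₁B ≤ 2 ^ k * L := le_trans hLB (Nat.le_mul_of_pos_left L (Nat.two_pow_pos k))
  have hpow := renyiTwo_le_pow_of_contraction r.ρ β hs hθ hθ1 hL'B hk (fun L' hL' h => hcon β hβB L' hL' h)
  -- choose `j` with `θ^j s ≤ ε`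
  obtain ⟨j, hj⟩ := exists_pow_lt_of_lt_one (div_pos hε hs) hθ1
  have hjε : θ ^ j * s ≤ ε := by
    have := (lt_div_iff₀ hs).mp hj
    exact this.le
  refine ⟨2 ^ j * (2 ^ k * L), ?_, ?_⟩
  · calc L₀ ≤ L := hL0
      _ ≤ 2 ^ k * L := Nat.le_mul_of_pos_left L (Nat.two_pow_pos k)
      _ ≤ 2 ^ j * (2 ^ k * L) := Nat.le_mul_of_pos_left _ (Nat.two_pow_pos j)
  · calc coldDefect r.ρ β (2 ^ j * (2 ^ k * L)) ≤ renyiTwo r.ρ β (2 ^ j * (2 ^ k * L)) :=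
          coldDefect_le_renyiTwo r.continuous β _
      _ ≤ θ ^ j * s := hpow j
      _ ≤ ε := hjε

/-! ## §4 REGISTERED STUBS and the kernel-checked composition concluding `BalabanLadder.IR` BY NAME -/

/-- stub A (LOAD, XL): the hot octave decrement. -/
theorem stub_hotOctaveDecrement : HotOctaveDecrementSC := by
  sorry

/-- stub B (L–XL): the cold octave contraction. -/
theorem stub_coldOctaveHalving : ColdOctaveHalvingSC := by
  sorry

/-- stub X (inherited, shared with lines doubling-bridge / aspect-bootstrap): the pincer's asymptotic-freedom pin, BY NAME. -/
theorem stub_afToColdPressure : AFToColdPressure := by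
  sorry

/-- stub N (inherited residual, shared): the non-simply-connected / remaining case `IRnsc`, BY NAME. -/
theorem stub_irnsc : IRnsc := by
  sorry

/-- **The line concludes the crux BY NAME.**  `E := coldExitSC_of_staircase A B`; `R := coldDoublingRecursionSC_holds`
(tree, p596893); then `ColdPurityBridge.IR_of_bridge R E X N`.  Kernel-checked; no sorry outside the four stubs. -/
theorem IR_of (hA : HotOctaveDecrementSC) (hB : ColdOctaveHalvingSC) (hX : AFToColdPressure) (hN : IRnsc) :
    Summit.QuantumFields.YangMills.Theses.BalabanLadder.IR :=
  IR_of_bridge AspectBootstrap.coldDoublingRecursionSC_holds (coldExitSC_of_staircase hA hB) hX hN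

/-- The composition over the registered stubs. -/
theorem IR_of_stubs : Summit.QuantumFields.YangMills.Theses.BalabanLadder.IR :=
  IR_of stub_hotOctaveDecrement stub_coldOctaveHalving stub_afToColdPressure stub_irnsc

end Summit.QuantumFields.YangMills.Cruxes.IR.EntropyStaircase

end
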